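import Summits.QuantumFields.YangMills.Theorems.PoincareLipschitzSphereMapSmallRangeEnergyDecay
import Summits.QuantumFields.YangMills.Theorems.PoincareLipschitzSphereMapInteriorComparison

/-!
# Line «poincare_lipschitz» on crux `HistoryTailL` (stmt-QuantumFields-19936), route crux `BlockLipschitzL` (stmt-QuantumFields-23533), K2 organ of record LOC-REG-MIN —
# FLAT SHADOW «ENERGY → RANGE» (E→R) FOR LATTICE MINIMISERS INTO A SPHERE, FILE 5d-A: ENERGY DECAY FROM THE INTERIOR COMPARISON —
# the vector harmonic EXTENSION on a box, `E(u;Q) ≤ 2E(h;Q) + 2E(u − h;Q)`, and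
# `E(u; Q_ρ) ≤ 2A_d((ρ+1)∕(R−1))^d·E(u; Q_R) + 2·[Λ + (m⁻² − 1)E(u;Q_R) + m⁻²(2√(E·X) + X)]` — the shape of px8's socket `hone`

Cell `ym3-torus` (YM ladder rung R3 = continuum SU(2) Yang–Mills on the three-torus — a RUNG, NOT the Clay problem: not d = 4, not infinite volume, not a mass gap); width seat
`ym-ust-19936-w5` gen 12 (LEAD ym-ust-19936-w1 g8 2026-08-29T05:29:02Z END-GAME «[C] = E→R F5 (★w5) + F6 (px8)»; my LOCATE `E2R-ROAD-w5g12.md` §2 (vii), §3 F5).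
THEOREMS ONLY (def-free), values in a finite-dimensional real inner-product space `V` (px7's vector Dirichlet problem), lattice letters of lit ✓`B4Eq19LatticeOperators`; composes
px7 g5's ✓`PoincareLipschitzSphereMapSmallRangeEnergyDecay` (`exists_vec_dirichlet`, `vec_harmonic_decay`) with ★w5 g12's ✓`PoincareLipschitzSphereMapInteriorComparison`
(`energy_eq_of_eq_off`, `interior_comparison`); `--supports stmt-QuantumFields-19936`.  Nothing here proves E→R, LOC-REG-MIN, `hReg`, `hImprove`, a stub, `BlockLipschitzL`,
`HistoryTailL` or a summit statement; nothing twisted ∕ covariant is in this file.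
* §1 ★ `exists_vec_harmonic_extension` — for every `f` and box `Q_r(z)` (`d ≥ 1`) there is `h` componentwise harmonic on `Q_r(z)` with `h = f` off `Q_r(z)`.
* §2 `normSq_le_two_mul_add` (`‖a‖² ≤ 2‖b‖² + 2‖a − b‖²`), ★ `energy_le_two_mul_add` (`E(u;Q) ≤ 2E(h;Q) + 2E(u − h;Q)`).
* §3 ★★ `energy_decay_of_defect` — `h′` componentwise harmonic on `Q_{R−1}(z)`, `h′ = u` off it, `0 ≤ ρ ≤ R − 2` ⟹
  `E(u; Q_ρ(z)) ≤ 2·A_d·((ρ+1)∕(R−1))^d·E(u; Q_R(z)) + 2·E(u − h′; Q_R(z))`, `A_d = 2^d(1+56d)^d(8(d+1))^{d+1}` (px7's ✓`vec_harmonic_decay` on `h′`, `E(h′) ≤ E(u)` by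
  Pythagoras ✓`energy_eq_of_eq_off`, monotonicity in the box).
* §4 ★★★ `energy_decay_of_comparison` — §3 ∘ ✓`interior_comparison`: under the hypotheses of the interior comparison (`c`, `H`, `m`, `Λ`, minimality inequality) and
  `0 ≤ ρ ≤ R − 2`: `E(u; Q_ρ) ≤ 2A_d((ρ+1)∕(R−1))^d·E(u;Q_R) + 2·(Λ + (m⁻² − 1)·E(u;Q_R) + m⁻²·(2√(E(u;Q_R)·X) + X))`, `X = E(c − u; Q_R)` — the ONE-STEP IMPROVEMENT
  modulo the three smallness suppliers (`Λ`, `1 − m`, `X` against `E`), which F5d-B∕C discharge from the multi-scale good shell.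
[folklore] ([SchoenUhlenbeck1982] §4; [Giaquinta1984] Ch. III §2; the lattice statements are this file's).
-/

set_option autoImplicit false

noncomputable section

open scoped BigOperators InnerProductSpace
open Finset

namespace Summit.QuantumFields.YangMills.Theorems.PoincareLipschitzSphereMapEnergyDecayOfComparison

open Literature.MathematicalPhysics.QuantumFieldTheory.Balaban1983to89
open B4Eq19LatticeOperators
open Summit.QuantumFields.YangMills.Theorems.PoincareLipschitzSphereMapSmallRangeEnergyDecay (exists_vec_dirichlet vec_harmonic_decay)
open Summit.QuantumFields.YangMills.Theorems.PoincareLipschitzSphereMapInteriorComparison (energy_eq_of_eq_off interior_comparison)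

variable {d : ℕ} {V : Type*} [NormedAddCommGroup V] [InnerProductSpace ℝ V]

/-! ## §1 The vector harmonic extension on a box -/

/-- ★ **HARMONIC EXTENSION**: for every `f : ℤ^d → V` (`V` finite-dimensional, `d ≥ 1`) and every box `Q_r(z)` there is `h` with `h = f` off `Q_r(z)` and
`Σ_μ ((h y + h y) − h(y−e_μ) − h(y+e_μ)) = 0` on `Q_r(z)` (`h = f + w`, `w` the solution of px7's vector Dirichlet problem with right-hand side `−(−Δf)`). [folklore]
[cite: Giaquinta1984, Ch. III §2 p.78] -/
theorem exists_vec_harmonic_extension [FiniteDimensional ℝ V] (hd : 0 < d) (z : Zd d) (r : ℤ) (f : Zd d → V) :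
    ∃ h : Zd d → V, (∀ y ∉ box z r, h y = f y) ∧ ∀ y ∈ box z r, ∑ μ, ((h y + h y) - h (y - unitVec μ) - h (y + unitVec μ)) = 0 := by
  obtain ⟨w, hw0, hw⟩ := exists_vec_dirichlet hd z r (fun y => -∑ μ, ((f y + f y) - f (y - unitVec μ) - f (y + unitVec μ)))
  refine ⟨fun y => f y + w y, fun y hy => by simp [hw0 y hy], fun y hy => ?_⟩
  have h1 := hw y hy
  have e : ∑ μ, (((f y + w y) + (f y + w y)) - (f (y - unitVec μ) + w (y - unitVec μ)) - (f (y + unitVec μ) + w (y + unitVec μ))) =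
      ∑ μ, ((f y + f y) - f (y - unitVec μ) - f (y + unitVec μ)) + ∑ μ, ((w y + w y) - w (y - unitVec μ) - w (y + unitVec μ)) := by
    rw [← Finset.sum_add_distrib]; exact Finset.sum_congr rfl fun μ _ => by abel
  rw [e, h1]; abel

/-! ## §2 `E(u) ≤ 2E(h) + 2E(u − h)` -/

omit [InnerProductSpace ℝ V] in
/-- `‖a‖² ≤ 2‖b‖² + 2‖a − b‖²`. [folklore] -/
theorem normSq_le_two_mul_add (a b : V) : ‖a‖ ^ 2 ≤ 2 * ‖b‖ ^ 2 + 2 * ‖a - b‖ ^ 2 := by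
  have h1 : ‖a‖ ≤ ‖b‖ + ‖a - b‖ := by
    have := norm_add_le b (a - b); rwa [add_sub_cancel] at this
  have h0 : 0 ≤ ‖a‖ := norm_nonneg _
  nlinarith [norm_nonneg b, norm_nonneg (a - b), sq_nonneg (‖b‖ - ‖a - b‖)]

omit [InnerProductSpace ℝ V] in
/-- ★ **`E(u; Q) ≤ 2·E(h; Q) + 2·E(u − h; Q)`** for the bond energy on any finite set of sites. [folklore] -/
theorem energy_le_two_mul_add (Q : Finset (Zd d)) (u h : Zd d → V) :
    ∑ y ∈ Q, ∑ μ, ‖u (y + unitVec μ) - u y‖ ^ 2 ≤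
      2 * ∑ y ∈ Q, ∑ μ, ‖h (y + unitVec μ) - h y‖ ^ 2 + 2 * ∑ y ∈ Q, ∑ μ, ‖(u (y + unitVec μ) - h (y + unitVec μ)) - (u y - h y)‖ ^ 2 := by
  rw [Finset.mul_sum, Finset.mul_sum, ← Finset.sum_add_distrib]
  refine Finset.sum_le_sum fun y _ => ?_
  rw [Finset.mul_sum, Finset.mul_sum, ← Finset.sum_add_distrib]
  refine Finset.sum_le_sum fun μ _ => ?_
  have := normSq_le_two_mul_add (u (y + unitVec μ) - u y) (h (y + unitVec μ) - h y)
  have e : (u (y + unitVec μ) - u y) - (h (y + unitVec μ) - h y) = (u (y + unitVec μ) - h (y + unitVec μ)) - (u y - h y) := by abel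
  rw [e] at this; exact this

/-! ## §3 Decay from the defect -/

/-- ★★ **ENERGY DECAY FROM THE DEFECT**: `V` finite-dimensional; `h′` componentwise harmonic on `Q_{R−1}(z)` with `h′ = u` off `Q_{R−1}(z)`; `0 ≤ ρ ≤ R − 2`.  THEN
`E(u; Q_ρ(z)) ≤ 2·A_d·((ρ+1)∕(R−1))^d·E(u; Q_R(z)) + 2·E(u − h′; Q_R(z))` with `A_d = 2^d(1+56d)^d(8(d+1))^{d+1}`. [folklore]
[cite: SchoenUhlenbeck1982, §4; Giaquinta1984, Ch. III §2] -/
theorem energy_decay_of_defect [FiniteDimensional ℝ V] (u h' : Zd d → V) (z : Zd d) {ρ R : ℤ} (hρ : 0 ≤ ρ) (hρR : ρ ≤ R - 2)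
    (hh' : ∀ y ∈ box z (R - 1), ∑ μ, ((h' y + h' y) - h' (y - unitVec μ) - h' (y + unitVec μ)) = 0) (hh'u : ∀ y ∉ box z (R - 1), h' y = u y) :
    ∑ y ∈ box z ρ, ∑ μ, ‖u (y + unitVec μ) - u y‖ ^ 2 ≤
      2 * ((2 : ℝ) ^ d * (1 + 56 * d) ^ d * (8 * ((d : ℝ) + 1)) ^ (d + 1) * (((ρ : ℝ) + 1) / (((R - 2 : ℤ) : ℝ) + 1)) ^ d) *
          ∑ y ∈ box z R, ∑ μ, ‖u (y + unitVec μ) - u y‖ ^ 2 +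
        2 * ∑ y ∈ box z R, ∑ μ, ‖(u (y + unitVec μ) - h' (y + unitVec μ)) - (u y - h' y)‖ ^ 2 := by
  have hRR : R - 2 + 1 = R - 1 := by ring
  have hdec := vec_harmonic_decay (z := z) hρ hρR h' (by rw [hRR]; exact hh')
  -- `E(h'; Q_{R−2}) ≤ E(h'; Q_R) ≤ E(u; Q_R)`
  have hmono : ∑ y ∈ box z (R - 2), ∑ μ, ‖h' (y + unitVec μ) - h' y‖ ^ 2 ≤ ∑ y ∈ box z R, ∑ μ, ‖h' (y + unitVec μ) - h' y‖ ^ 2 :=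
    Finset.sum_le_sum_of_subset_of_nonneg (box_mono z (by linarith)) fun _ _ _ => Finset.sum_nonneg fun _ _ => by positivity
  have hP := energy_eq_of_eq_off h' u z R hh' (fun y hy => (hh'u y hy).symm)
  have hD0 : 0 ≤ ∑ y ∈ box z R, ∑ μ : Fin d, ‖(u (y + unitVec μ) - h' (y + unitVec μ)) - (u y - h' y)‖ ^ 2 :=
    Finset.sum_nonneg fun _ _ => Finset.sum_nonneg fun _ _ => by positivity
  have hhu : ∑ y ∈ box z R, ∑ μ, ‖h' (y + unitVec μ) - h' y‖ ^ 2 ≤ ∑ y ∈ box z R, ∑ μ, ‖u (y + unitVec μ) - u y‖ ^ 2 := by rw [hP]; linarith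
  -- defect on the small box ≤ defect on the big box
  have hDmono : ∑ y ∈ box z ρ, ∑ μ, ‖(u (y + unitVec μ) - h' (y + unitVec μ)) - (u y - h' y)‖ ^ 2 ≤
      ∑ y ∈ box z R, ∑ μ, ‖(u (y + unitVec μ) - h' (y + unitVec μ)) - (u y - h' y)‖ ^ 2 :=
    Finset.sum_le_sum_of_subset_of_nonneg (box_mono z (by linarith)) fun _ _ _ => Finset.sum_nonneg fun _ _ => by positivity
  have h2 := energy_le_two_mul_add (box z ρ) u h'
  have hA : 0 ≤ (2 : ℝ) ^ d * (1 + 56 * d) ^ d * (8 * ((d : ℝ) + 1)) ^ (d + 1) * (((ρ : ℝ) + 1) / (((R - 2 : ℤ) : ℝ) + 1)) ^ d := by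
    have : (0 : ℝ) ≤ ((ρ : ℝ) + 1) / (((R - 2 : ℤ) : ℝ) + 1) := by
      apply div_nonneg (by positivity); push_cast; linarith [(show (ρ : ℝ) ≤ (R : ℝ) - 2 by exact_mod_cast hρR), (show (0:ℝ) ≤ ρ by exact_mod_cast hρ)]
    positivity
  calc _ ≤ _ := h2
    _ ≤ 2 * ((2 : ℝ) ^ d * (1 + 56 * d) ^ d * (8 * ((d : ℝ) + 1)) ^ (d + 1) * (((ρ : ℝ) + 1) / (((R - 2 : ℤ) : ℝ) + 1)) ^ d *
          ∑ y ∈ box z R, ∑ μ, ‖u (y + unitVec μ) - u y‖ ^ 2) +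
        2 * ∑ y ∈ box z R, ∑ μ, ‖(u (y + unitVec μ) - h' (y + unitVec μ)) - (u y - h' y)‖ ^ 2 := by
          have h3 := hdec.trans (mul_le_mul_of_nonneg_left (hmono.trans hhu) hA)
          linarith
    _ = _ := by ring

/-! ## §4 Decay from the interior comparison -/

/-- ★★★ **THE ONE-STEP IMPROVEMENT MODULO ITS THREE SMALLNESS SUPPLIERS.**  `V` finite-dimensional; on `Q_R(z)`: the field `u`, a field `c`, `h′` (harmonic on
`Q_{R−1}`, `= u` off it), `H` (harmonic on `Q_{R−1}`, `= c` off it, `m ≤ ‖H‖` on `Q_R` and forward neighbours, `0 < m ≤ 1`), the minimality inequality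
`E(u;Q_R) ≤ Λ + E(π∘H;Q_R)`, and `0 ≤ ρ ≤ R − 2`.  THEN
`E(u; Q_ρ) ≤ 2A_d((ρ+1)∕(R−1))^d·E(u;Q_R) + 2·(Λ + (m⁻² − 1)·E(u;Q_R) + m⁻²·(2√(E(u;Q_R)·X) + X))`, `X = E(c − u; Q_R)`.  With `Λ, X ≤ δE` and `1 − m ≤ η` this is
`E(u;Q_ρ) ≤ (2A_d((ρ+1)∕(R−1))^d + ε(δ,η))·E(u;Q_R)` — px8's socket `hone` up to the radius bookkeeping. [folklore] [cite: SchoenUhlenbeck1982, §4] -/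
theorem energy_decay_of_comparison [FiniteDimensional ℝ V] (u c h' H : Zd d → V) (z : Zd d) {ρ R : ℤ} (hρ : 0 ≤ ρ) (hρR : ρ ≤ R - 2)
    {m Λ : ℝ} (hm : 0 < m) (hm1 : m ≤ 1)
    (hh' : ∀ y ∈ box z (R - 1), ∑ μ, ((h' y + h' y) - h' (y - unitVec μ) - h' (y + unitVec μ)) = 0) (hh'u : ∀ y ∉ box z (R - 1), h' y = u y)
    (hH : ∀ y ∈ box z (R - 1), ∑ μ, ((H y + H y) - H (y - unitVec μ) - H (y + unitVec μ)) = 0) (hHc : ∀ y ∉ box z (R - 1), H y = c y)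
    (hmQ : ∀ y ∈ box z R, m ≤ ‖H y‖) (hmQ' : ∀ y ∈ box z R, ∀ μ : Fin d, m ≤ ‖H (y + unitVec μ)‖)
    (hmin : ∑ y ∈ box z R, ∑ μ, ‖u (y + unitVec μ) - u y‖ ^ 2 ≤
      Λ + ∑ y ∈ box z R, ∑ μ, ‖(‖H (y + unitVec μ)‖)⁻¹ • H (y + unitVec μ) - (‖H y‖)⁻¹ • H y‖ ^ 2) :
    ∑ y ∈ box z ρ, ∑ μ, ‖u (y + unitVec μ) - u y‖ ^ 2 ≤
      2 * ((2 : ℝ) ^ d * (1 + 56 * d) ^ d * (8 * ((d : ℝ) + 1)) ^ (d + 1) * (((ρ : ℝ) + 1) / (((R - 2 : ℤ) : ℝ) + 1)) ^ d) *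
          ∑ y ∈ box z R, ∑ μ, ‖u (y + unitVec μ) - u y‖ ^ 2 +
        2 * (Λ + ((m ^ 2)⁻¹ - 1) * ∑ y ∈ box z R, ∑ μ, ‖u (y + unitVec μ) - u y‖ ^ 2 +
          (m ^ 2)⁻¹ * (2 * Real.sqrt ((∑ y ∈ box z R, ∑ μ, ‖u (y + unitVec μ) - u y‖ ^ 2) *
              (∑ y ∈ box z R, ∑ μ, ‖(c (y + unitVec μ) - u (y + unitVec μ)) - (c y - u y)‖ ^ 2)) +
            ∑ y ∈ box z R, ∑ μ, ‖(c (y + unitVec μ) - u (y + unitVec μ)) - (c y - u y)‖ ^ 2)) := by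
  have h1 := energy_decay_of_defect u h' z hρ hρR hh' hh'u
  have h2 := interior_comparison u c h' H z R hm hm1 hh' hh'u hH hHc hmQ hmQ' hmin
  linarith

end Summit.QuantumFields.YangMills.Theorems.PoincareLipschitzSphereMapEnergyDecayOfComparison
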